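import Literature.NumberTheory.Automorphic.ClozelAlgebraicity
import Literature.NumberTheory.Automorphic.GLOneOfHeckeCharacterBJ
import Literature.NumberTheory.GaloisRepresentations.HeckeCharacterAutConj
import HarnessLib

/-!
# Clozel's algebraicity fact for `GL₁`: the `Aut(ℂ)`-conjugates of the representation of an
# algebraic Hecke character (proofs)

Proofs-only companion (theorems, no definitions, no named facts) of `ClozelAlgebraicity.lean`,
rank one. An algebraic Hecke character `χ` of `K` (Weil's type `A₀`, infinity type `(p, q)`) has
`Aut(ℂ)`-conjugates `^σχ` (`HeckeCharacter.HasInfinityType.autConj`, file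
`GaloisRepresentations/HeckeCharacterAutConj`: Weil 1956, §1), with `(^σχ)(ϖ_w) = σ(χ(ϖ_w))`. In
the Borel–Jacquet model of the tree the automorphic representation of `GL₁(𝔸_K)` attached to a
Hecke character `θ` is the line `π_θ = ℂ·(θ∘det) / ⊥` (`exists_automorphicRepData_detTwist_glOne`),
with Satake parameter `{θ(⟨ϖ⟩_w)}` off a level of `θ` (`hasSatakeParamAt_detTwist_glOne`). Hence:

* `isAutConjugate_glOne_autConj` — **`π_{^σχ}` is the `σ`-conjugate of `π_χ` at almost all
  places** (`IsAutConjugate σ π_χ π_{^σχ}`: at every `w` off levels of `χ` and of `^σχ`, the single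
  Hecke eigenvalue `t_{w,1} = χ(ϖ_w)` becomes `σ(χ(ϖ_w))`, and `t_{w,0} = 1`);
* `exists_isAutConjugate_glOne_of_isAlgebraic` — existence form: for every `σ ∈ Aut(ℂ)` the
  representation `π_χ` of an algebraic `χ` has a `σ`-conjugate automorphic representation of
  `GL₁(𝔸_K)` — the finite part of clause (ii) of `Clozel1990_regularAlgebraic` for `n = 1` on the
  representations of algebraic Hecke characters (Clozel 1990, Thm. 3.13 with §1: for `n = 1` the
  theorem is Weil's; Patrikis 2019, §2.4).

What is not here: the archimedean clause (the infinity type of `π_{^σχ}` is `^σ` of that of `π_χ`),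
which needs the identification of the archimedean parameter of `π_θ` with the infinity type of `θ`
(`AutomorphicRepsGLOneArchParameter`), and the passage from an arbitrary cuspidal regular algebraic
datum on `GL₁` to a `π_χ` (the datum ↦ character direction of the dictionary).

## References

* A. Weil, *On a certain type of characters of the idèle-class group of an algebraic
  number-field* (1956), §1. [Weil1956]
* L. Clozel, *Motifs et formes automorphes*, in Automorphic forms, Shimura varieties, and
  L-functions I (1990), §1 and Thm. 3.13. [Clozel1990]
* A. Borel, H. Jacquet, *Automorphic forms and automorphic representations* (1979), §4.6.
  [BorelJacquet1979]
-/

noncomputable section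

open scoped Classical
open NumberField IsDedekindDomain

namespace Literature.NumberTheory.Automorphic

open Literature.NumberTheory.GaloisRepresentations (HeckeCharacter ideleGroup localUnits)

variable {K : Type} [Field K] [NumberField K] {hcpt : isCompact_glFiniteIntegralLevel 1 K}

/-- In rank one the Hecke eigenvalues of the singleton parameter `{σ a}` are the `σ`-conjugates of
those of `{a}`: `t_{w,0} = 1`, `t_{w,1} = a` (`q_w^{1·0/2} = 1`). [folklore] -/
theorem heckeEigenvalueOf_one_singleton_map (σ : ℂ ≃ₐ[ℚ] ℂ) (w : HeightOneSpectrum (𝓞 K)) (a : ℂ)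
    {i : ℕ} (hi : i ≤ 1) :
    heckeEigenvalueOf 1 w {σ a} i = σ (heckeEigenvalueOf 1 w {a} i) := by
  rcases Nat.le_one_iff_eq_zero_or_eq_one.1 hi with rfl | rfl
  · simp [heckeEigenvalueOf, Multiset.esymm]
  · simp [heckeEigenvalueOf, Multiset.esymm, Multiset.powersetCard_one]

/-- **`π_{^σχ}` is the `σ`-conjugate of `π_χ` at almost all places.** Let `χ` be a Hecke character
of infinity type `(p, q)`, `σ ∈ Aut(ℂ)`, and let `π`, `π'` be the Borel–Jacquet representations of
`GL₁(𝔸_K)` on the lines `ℂ·(χ∘det)` and `ℂ·(^σχ∘det)` over `⊥`. Then at every finite place `w`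
off a level of `χ` and a level of `^σχ` (all but finitely many), `π` has Satake parameter
`{χ(ϖ_w)}` and `π'` has Satake parameter `{(^σχ)(ϖ_w)} = {σ(χ(ϖ_w))}`
(`HasInfinityType.localComponent_autConj`), whose Hecke eigenvalues are the `σ`-conjugates:
`IsAutConjugate σ π π'`. This is clause (ii) of Clozel 1990, Thm. 3.13 (finite part) for `n = 1` on
`π_χ` — Weil 1956. [cite: Clozel1990, Thm. 3.13 (n = 1)] [cite: Weil1956, §1] -/
theorem isAutConjugate_glOne_autConj {χ : HeckeCharacter K} {p q : InfinitePlace K → ℤ}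
    (h : χ.HasInfinityType p q) (σ : ℂ ≃ₐ[ℚ] ℂ)
    {π π' : AutomorphicRepData (AutomorphyDatum.gl 1 K hcpt)}
    (hW : π.W = Submodule.span ℂ {fun g : (AdelicGroupData.gl 1 K).Adelic ↦ (detTwist 1 χ g : ℂ)})
    (hW' : π.W' = ⊥)
    (hW₂ : π'.W = Submodule.span ℂ
      {fun g : (AdelicGroupData.gl 1 K).Adelic ↦ (detTwist 1 (h.autConj σ) g : ℂ)})
    (hW₂' : π'.W' = ⊥) :
    IsAutConjugate σ π π' := by
  obtain ⟨𝔪, h𝔪, hχ𝔪⟩ := χ.exists_level_glOne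
  obtain ⟨𝔪', h𝔪', hχ𝔪'⟩ := (h.autConj σ).exists_level_glOne
  -- off the prime divisors of `𝔪` and `𝔪'`
  have hfin : {w : HeightOneSpectrum (𝓞 K) | w.asIdeal ∣ 𝔪 ∨ w.asIdeal ∣ 𝔪'}.Finite :=
    (Ideal.finite_factors h𝔪).union (Ideal.finite_factors h𝔪')
  change ∀ᶠ w : HeightOneSpectrum (𝓞 K) in Filter.cofinite, _
  filter_upwards [hfin.compl_mem_cofinite] with w hw
  simp only [Set.mem_compl_iff, Set.mem_setOf_eq, not_or] at hw
  set ϖ := GaloisRepresentations.HeckeCharacter.uniformizer K w with hϖ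
  have hϖv := GaloisRepresentations.HeckeCharacter.valued_uniformizer (K := K) w
  refine ⟨{((χ (localUnits w ϖ) : ℂˣ) : ℂ)}, {(((h.autConj σ) (localUnits w ϖ) : ℂˣ) : ℂ)},
    AutomorphicRepData.hasSatakeParamAt_detTwist_glOne hcpt hW hW' h𝔪 hχ𝔪 w hw.1 hϖv,
    AutomorphicRepData.hasSatakeParamAt_detTwist_glOne hcpt hW₂ hW₂' h𝔪' hχ𝔪' w hw.2 hϖv,
    fun i hi ↦ ?_⟩
  have e : (((h.autConj σ) (localUnits w ϖ) : ℂˣ) : ℂ) = σ ((χ (localUnits w ϖ) : ℂˣ) : ℂ) :=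
    h.autConj_apply_of_fst_eq_one σ (GaloisRepresentations.localUnits_fst w ϖ)
  rw [e]
  exact heckeEigenvalueOf_one_singleton_map σ w _ hi

/-- **Clause (ii) of Clozel's theorem for `n = 1`, finite part, on the representations of algebraic
Hecke characters**: for every algebraic Hecke character `χ` of `K` and every `σ ∈ Aut(ℂ)`, the
Borel–Jacquet representation `π_χ = ℂ·(χ∘det)/⊥` of `GL₁(𝔸_K)` has a `σ`-conjugate automorphic
representation of `GL₁(𝔸_K)` at almost all places, namely `π_{^σχ}` (Weil 1956; Clozel 1990,
Thm. 3.13 for `n = 1`). [cite: Clozel1990, Thm. 3.13 (n = 1)] [cite: Weil1956, §1] -/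
theorem exists_isAutConjugate_glOne_of_isAlgebraic {χ : HeckeCharacter K} (hχ : χ.IsAlgebraic)
    (σ : ℂ ≃ₐ[ℚ] ℂ) {π : AutomorphicRepData (AutomorphyDatum.gl 1 K hcpt)}
    (hW : π.W = Submodule.span ℂ {fun g : (AdelicGroupData.gl 1 K).Adelic ↦ (detTwist 1 χ g : ℂ)})
    (hW' : π.W' = ⊥) :
    ∃ π' : AutomorphicRepData (AutomorphyDatum.gl 1 K hcpt), IsAutConjugate σ π π' := by
  obtain ⟨p, q, h⟩ :=
    (GaloisRepresentations.HeckeCharacter.isAlgebraic_iff_exists_hasInfinityType χ).mp hχ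
  obtain ⟨π', hW₂, hW₂'⟩ := exists_automorphicRepData_detTwist_glOne hcpt (h.autConj σ)
  exact ⟨π', isAutConjugate_glOne_autConj h σ hW hW' hW₂ hW₂'⟩

end Literature.NumberTheory.Automorphic
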